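import Summits.ResolutionOfSingularities.ResolutionOfSingularities.Theorems.WildConesCampaignW46ForcedAtomExitBoundAll
import HarnessLib

/-!
# [OURS · L1 W4.6, rung (i) — brick 24, the degenerate dimension `n = 0`] The forced-atom regime in a ONE-dimensional
# ambient (`Regime.forcedAtom 0`: a `p`-fold point `z^p` on a regular curve germ) is resolved by ONE blow-up:
# `FinLocalExitBound (Regime.forcedAtom 0)` with `β = 1` and `PermissiblyTerminates (Regime.forcedAtom 0)`
# (cell res-hironaka, LADDER-RESOLUTION rung L, D-0089; slot W4.6, seat res-L1-s46-pv-2 gen 4; host route `WildCones`,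
# crux `ClassicalRegimes` stmt-ResolutionOfSingularities-16884, `--supports … --as helper`)

HONEST FRAMING. Everything here is OURS. NOTHING below is a statement of H. Hironaka's manuscript [Hironaka2017]; o1's
`FinPermissibleRun` / `FinLocalExitBound` / `PermissiblyTerminates` and `Regime.forcedAtom` (p517839) and the typed
carriers of row 001 enter as DEFINITIONS; no FACT-LIST premise. AI review is weaker than expert review.

## What is proved (closing residue (R2) «`n = 0`» of this seat's gen-3 census)

This seat's dictionary and rungs (p516034 … brick 22 p537008) assume `0 < n`: the one step
`exists_presentation_transform_of_isBlowup` needs the multiplicity-`p` predicate `MultP`, which fails for the empty set of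
`u`-variables (the cleaned series of a state in `0` variables is `0`, the atom is `z^p`). In dimension `n = 0` the regime
is degenerate and is settled directly:

* `ForcedAtom.not_mem_sing_transform_of_forcedAtom_zero` — **`K` algebraically closed: if `(A, E) ∈ Regime.forcedAtom 0`,
  `ξ ∈ Sing(E)`, `D = {ξ}` and `π : Z′ → Z` is the blow-up along `𝓘_D`, then NO closed point of `Z′` is a singular point
  of the transform `E′`.** At `ξ` the maximal ideal is principal, `𝔪_ξ = (c)` (embedding dimension `0 + 1`), and the
  presentation `E₀(f₀) = w₀·(z^p − 0)` forces `f₀ = c^p · v` with `v` a unit (orders are read in the completion); at a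
  closed point `ξ′` over `ξ` the chart data of brick 6 (`exists_stalk_chartData_nzd`) make `π^♯(c)` a non-zero-divisor and
  brick 12 (`stalkIdeal_transform_eq_span`) gives `J′_{ξ′} = (π^♯ v) = 𝒪_{Z′,ξ′}`, of order `0 < p`.
* `ForcedAtom.finLocalExitBound_forcedAtom_zero : FinLocalExitBound (Regime.forcedAtom 0)` with `β = 1` (a second blow-up
  would need a closed singular point of the first transform), and
  `ForcedAtom.permissiblyTerminates_forcedAtom_zero : PermissiblyTerminates (Regime.forcedAtom 0)` (o1's
  `permissiblyTerminates_of_finLocalExitBound`). With brick 22 the forced-atom rung now has a number in EVERY `n ≥ 0`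
  over algebraically closed fields.

References: bricks 6 (p506049 `exists_stalk_chartData_nzd`), 11 (p506855), 12 (p507654/p523688 `stalkIdeal_transform_eq_span`,
`mem_sing_transform_iff`), p516034's `exists_rsop_adapted` / `mem_maximalIdeal_pow_iff_ringEquiv`; res-L1-type-o1 p488284 /
p517839. [folklore]
-/

noncomputable section

-- single-problem summit: the doubled namespace component `ResolutionOfSingularities` is forced
set_option linter.dupNamespace false

open scoped BigOperators Classical
open MvPowerSeries IsLocalRing

namespace Summit.ResolutionOfSingularities.ResolutionOfSingularities.Theorems

namespace CampaignW46.ForcedAtom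

open CategoryTheory AlgebraicGeometry TopologicalSpace
open Literature.AlgebraicGeometry.Resolution
open Literature.AlgebraicGeometry.Hironaka2017.S02Preliminaries
open Literature.AlgebraicGeometry.Hironaka2017.Datum
open Scheme.IdealSheafData
open WildCones
open CampaignW46.ChartPoint CampaignW46.AtomGerm CampaignW46.FormalChart

variable {p : ℕ} [Fact p.Prime] {K : Type} [Field K] [CharP K p] [IsAlgClosed K]

/-- [OURS · L1 W4.6 rung (i), `n = 0` — the ONE STEP; replaces the role of «the transform `E′` of `E` by the blowup with
center `D`» (H. Hironaka, ms. 2017, Def. 2.1 p.5) at a `p`-fold point of a one-dimensional ambient; NOT a statement of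
the manuscript] **In `Regime.forcedAtom 0` the blow-up of the singular point has no closed singular point.** [folklore] -/
theorem not_mem_sing_transform_of_forcedAtom_zero {A A' : AmbientDatum p K} (π : A'.Z ⟶ A.Z) (D : Closeds A.Z)
    (hπ : IsBlowup π (vanishingIdeal D)) (hhom : A'.hom = π ≫ A.hom) {E : IdealExponent A.Z}
    (hRg : Regime.forcedAtom (p := p) (K := K) 0 A E) {ξ : A.Z} (hξ : ξ ∈ E.sing) (hD : (D : Set A.Z) = {ξ})
    {ξ' : A'.Z} (hξ'cl : IsClosed ({ξ'} : Set A'.Z)) : ξ' ∉ (E.transform π D).sing := by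
  intro hξ'
  haveI : IsLocallyNoetherian A'.Z := ambient_isLocallyNoetherian A'
  have hp : p.Prime := Fact.out
  obtain ⟨hb, hS, hloc⟩ := hRg
  -- `ξ′` lies over the singular point
  have hDS : (D : Set A.Z) ⊆ E.sing := by
    rw [hD]
    exact Set.singleton_subset_iff.mpr hξ
  have hπξ : π ξ' = ξ := hS (sing_subset_of_transform hπ E hDS hξ') hξ
  subst hπξ
  haveI : IsRegularLocalRing (A.Z.presheaf.stalk (π ξ')) := ambient_isRegular A _
  haveI : IsRegularLocalRing (A'.Z.presheaf.stalk ξ') := ambient_isRegular A' _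
  obtain ⟨hd, ⟨E₀, f₀, c₀, w₀, hJ, hw, hf₀⟩, -⟩ := hloc (π ξ') hξ
  -- the local homomorphism `g = π^♯_{ξ′}`
  set g := (π.stalkMap ξ').hom with hg
  haveI hgloc : IsLocalHom g := inferInstance
  -- an adapted regular system of parameters at `π ξ′`: ONE element
  obtain ⟨c, hc, -⟩ := exists_rsop_adapted E₀
  have hcl : IsClosed ({π ξ'} : Set A.Z) := hD ▸ D.isClosed
  have hcJ : Ideal.span (Set.range c) = stalkIdeal (vanishingIdeal D) (π ξ') := by
    rw [hc, stalkIdeal_vanishingIdeal_eq_maximalIdeal_of_closure_eq]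
    rw [hD, hcl.closure_eq]
  -- `ξ′` is rational relative to `π`
  haveI : LocallyOfFiniteType (π ≫ A.hom) := by
    rw [← hhom]
    haveI := A'.smooth
    infer_instance
  have hrat : ∀ y : A'.Z.presheaf.stalk ξ', ∃ r : A.Z.presheaf.stalk (π ξ'),
      y - g r ∈ maximalIdeal (A'.Z.presheaf.stalk ξ') := fun y =>
    exists_sub_stalkMap_mem_maximalIdeal_of_isClosed π A.hom ξ' hξ'cl y
  -- chart data of the blow-up at `ξ′`
  have hd' : (maximalIdeal (A.Z.presheaf.stalk (π ξ'))).spanFinrank = Fintype.card (Option (Fin 0)) := by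
    rw [hd, Fintype.card_option, Fintype.card_fin]
  obtain ⟨i, e, τ, he, -, hnzd, -, -, -⟩ := exists_stalk_chartData_nzd hπ ξ' c hcJ hc hd' hrat
  -- `f₀ ∈ 𝔪^p ∖ 𝔪^{p+1}`
  have hf₀𝔪 : f₀ ∈ maximalIdeal (A.Z.presheaf.stalk (π ξ')) ^ p := by
    have h := hξ
    change (E.b : ℕ∞) ≤ idealOrder E.J _ at h
    rw [le_idealOrder_iff, hJ, Ideal.span_singleton_le_iff_mem, hb] at h
    exact h
  have hf₀𝔪' : f₀ ∉ maximalIdeal (A.Z.presheaf.stalk (π ξ')) ^ (p + 1) := by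
    rw [mem_maximalIdeal_pow_iff_ringEquiv E₀, hf₀]
    intro h
    obtain ⟨u, hu⟩ := hw
    have h' : (X none : MvPowerSeries (Option (Fin 0)) K) ^ p - rename (some : Fin 0 → Option (Fin 0)) (ser p 0 K c₀) ∈
        maximalIdeal (MvPowerSeries (Option (Fin 0)) K) ^ (p + 1) := by
      have := Ideal.mul_mem_left _ (↑u⁻¹ : MvPowerSeries (Option (Fin 0)) K) h
      rwa [← hu, ← mul_assoc, Units.inv_mul, one_mul] at this
    exact atom_not_mem_maximalIdeal_pow_succ hp.ne_zero _ h'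
  -- the maximal ideal is principal: `𝔪 = (c i)`
  have h𝔪 : maximalIdeal (A.Z.presheaf.stalk (π ξ')) = Ideal.span {c i} := by
    rw [← hc]
    congr 1
    ext x
    simp only [Set.mem_range, Set.mem_singleton_iff]
    constructor
    · rintro ⟨j, rfl⟩
      exact congrArg c (Subsingleton.elim j i)
    · rintro rfl
      exact ⟨i, rfl⟩
  -- `f₀ = (c i)^p · v` with `v` a unit
  obtain ⟨v, hv⟩ : ∃ v, v * c i ^ p = f₀ := by
    rw [h𝔪, Ideal.span_singleton_pow] at hf₀𝔪
    exact Ideal.mem_span_singleton'.mp hf₀𝔪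
  have hvu : IsUnit v := by
    by_contra hvn
    apply hf₀𝔪'
    have hv𝔪 : v ∈ maximalIdeal (A.Z.presheaf.stalk (π ξ')) := (IsLocalRing.mem_maximalIdeal v).mpr hvn
    rw [← hv, pow_succ', h𝔪, Ideal.span_singleton_pow]
    exact Ideal.mul_mem_mul (h𝔪 ▸ hv𝔪) (Ideal.mem_span_singleton_self _)
  -- the transform at `ξ′` is generated by the unit `g v`
  have hf' : g f₀ = g (c i) ^ E.b * g v := by
    rw [hb, ← hv, map_mul, map_pow, mul_comm]
  have hJ' : stalkIdeal (E.transform π D).J ξ' = Ideal.span {g v} :=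
    stalkIdeal_transform_eq_span hπ ξ' c hcJ i e he hnzd E f₀ hJ (g v) hf'
  have hgv𝔪 : g v ∈ maximalIdeal (A'.Z.presheaf.stalk ξ') := by
    have h := (mem_sing_transform_iff E ξ' (g v) hJ').mp hξ'
    rw [hb] at h
    exact Ideal.pow_le_self hp.ne_zero h
  exact (IsLocalRing.mem_maximalIdeal _).mp hgv𝔪 (hvu.map g)

/-- [OURS · L1 W4.6 rung (i), `n = 0`, WITH A NUMBER; replaces the role of Th. 16.13 p.87 l.25–28 of H. Hironaka's ms.
(2017) read, résumé-free, on FINITE §2.1-permissible sequences restricted to `Regime.forcedAtom 0`, in the exit-bound form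
of record; NOT a statement of the manuscript] **`FinLocalExitBound (Regime.forcedAtom 0)` with `β = 1`** over an
algebraically closed field: a finite permissible sequence inside the regime has at most ONE blow-up (the centre of a second
one would be a closed singular point of the first transform). [folklore] -/
theorem finLocalExitBound_forcedAtom_zero : FinLocalExitBound (Regime.forcedAtom (p := p) (K := K) 0) := by
  refine ⟨fun _ _ _ => 1, ?_⟩
  intro r hr x s hs
  -- `len ≤ 1`
  have hlen1 : r.len ≤ 1 := by
    by_contra hlt
    have hlen : 1 < r.len := by omega
    obtain ⟨ξ, hξ, hπξ, -⟩ := exists_centres r hr (Nat.zero_lt_of_lt hlen)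
    have hξS : ∀ k (hk : k < r.len), ξ k hk ∈ (r.E k).sing := fun k hk => by
      rw [(hξ k hk).2]
      exact Set.mem_singleton _
    have hcl : IsClosed ({ξ 1 hlen} : Set (r.A 1).Z) := by
      rw [← (hξ 1 hlen).1]
      exact (r.D 1).isClosed
    have h1 : ξ 1 hlen ∈ ((r.E 0).transform (r.π 0) (r.D 0)).sing := by
      rw [← r.E_succ 0 (Nat.zero_lt_of_lt hlen)]
      exact hξS 1 hlen
    exact not_mem_sing_transform_of_forcedAtom_zero (r.π 0) (r.D 0) (r.blowup 0 (Nat.zero_lt_of_lt hlen))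
      (r.hom_eq 0 (Nat.zero_lt_of_lt hlen)) (hr 0 (Nat.zero_le _)) (hξS 0 (Nat.zero_lt_of_lt hlen))
      (hξ 0 (Nat.zero_lt_of_lt hlen)).1 hcl h1
  calc s.card ≤ (Finset.range r.len).card :=
        Finset.card_le_card fun m hm => Finset.mem_range.mpr (hs m hm).1
    _ = r.len := Finset.card_range _
    _ ≤ 1 := hlen1

/-- [OURS · L1 W4.6 rung (i), `n = 0` — RÉSUMÉ-FREE; NOT a statement of the manuscript] **No infinite §2.1-permissible
sequence inside `Regime.forcedAtom 0`** over an algebraically closed field (o1's `permissiblyTerminates_of_finLocalExitBound`;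
`Sing` is finite in the regime). [folklore] -/
theorem permissiblyTerminates_forcedAtom_zero : PermissiblyTerminates (Regime.forcedAtom (p := p) (K := K) 0) :=
  permissiblyTerminates_of_finLocalExitBound (fun _ _ h => h.2.1.finite) finLocalExitBound_forcedAtom_zero

/-! ## Appendix (gen 4, after brick 22): the forced-atom rungs in EVERY dimension `n ≥ 0` -/

/-- [OURS · L1 W4.6 rung (i), `n = 0`; NOT a statement of the manuscript] o1's typed rung `ForcedAtomTerminates p K 0`
(every `m`, every notion instance `N`, every reading `Rd`) over an algebraically closed field, through o1's
`terminates_of_permissiblyTerminates`. [folklore] -/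
theorem forcedAtomTerminates_zero : ForcedAtomTerminates p K 0 :=
  fun _ N Rd => terminates_of_permissiblyTerminates N Rd permissiblyTerminates_forcedAtom_zero

/-- [OURS · L1 W4.6 rung (i), `n = 0`; NOT a statement of the manuscript] The ∇-centred twin
`ForcedAtomTerminatesNabla p K 0`. [folklore] -/
theorem forcedAtomTerminatesNabla_zero : ForcedAtomTerminatesNabla p K 0 :=
  forcedAtomTerminatesNabla_of_terminates forcedAtomTerminates_zero

/-- [OURS · L1 W4.6 rung (i) WITH A NUMBER in EVERY dimension `n ≥ 0`; NOT a statement of the manuscript] **Over an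
algebraically closed field of characteristic `p`, `FinLocalExitBound (Regime.forcedAtom n)` for EVERY `n`** (`n = 0`: this
file, `β = 1`; `n ≥ 1`: brick 22 `finLocalExitBound_forcedAtom_allDim`, `β = μ + 1`). [folklore] -/
theorem finLocalExitBound_forcedAtom_every (n : ℕ) : FinLocalExitBound (Regime.forcedAtom (p := p) (K := K) n) := by
  rcases Nat.eq_zero_or_pos n with rfl | hn
  · exact finLocalExitBound_forcedAtom_zero
  · exact finLocalExitBound_forcedAtom_allDim hn

/-- [OURS · L1 W4.6 rung (i) RÉSUMÉ-FREE in EVERY dimension `n ≥ 0`; NOT a statement of the manuscript] **Over an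
algebraically closed field of characteristic `p`, no infinite §2.1-permissible sequence lies inside `Regime.forcedAtom n`,
for EVERY `n`** (`n = 0`: this file; `n ≥ 1`: p523688 `permissiblyTerminates_forcedAtom`). [folklore] -/
theorem permissiblyTerminates_forcedAtom_every (n : ℕ) : PermissiblyTerminates (Regime.forcedAtom (p := p) (K := K) n) := by
  rcases Nat.eq_zero_or_pos n with rfl | hn
  · exact permissiblyTerminates_forcedAtom_zero
  · exact permissiblyTerminates_forcedAtom hn

/-- [OURS · L1 W4.6 rung (i)/(all `n`); NOT a statement of the manuscript] **o1's typed rung `ForcedAtomTerminates p K n`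
HOLDS for EVERY `n ≥ 0`** over an algebraically closed field (`n ≥ 1`: o1's `forcedAtomTerminates_holds` ∘ this seat's
p516034; `n = 0`: `forcedAtomTerminates_zero`). [folklore] -/
theorem forcedAtomTerminates_every (n : ℕ) : ForcedAtomTerminates p K n := by
  rcases Nat.eq_zero_or_pos n with rfl | hn
  · exact forcedAtomTerminates_zero
  · exact forcedAtomTerminates_holds hn

/-- [OURS · L1 W4.6 rung (i)/(all `n`); NOT a statement of the manuscript] The ∇-centred twin for every `n ≥ 0`.
[folklore] -/
theorem forcedAtomTerminatesNabla_every (n : ℕ) : ForcedAtomTerminatesNabla p K n :=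
  forcedAtomTerminatesNabla_of_terminates (forcedAtomTerminates_every n)

end CampaignW46.ForcedAtom

end Summit.ResolutionOfSingularities.ResolutionOfSingularities.Theorems

end
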